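import Literature.Analysis.FluidPDE.SobolevWholeSpace
import Literature.Analysis.FluidPDE.NSWeakStrongUniqueness
import Literature.Analysis.FunctionSpaces.Mollification
import HarnessLib

/-!
# Discharges for `NSWeakStrongUniqueness`: the Sobolev inequality for weak gradients and the measurability glue

Analysis/FluidPDE support file, sibling of `NSWeakStrongUniqueness` (the reduction of the
Serrin–Prodi weak–strong uniqueness fact `Literature.Analysis.FluidPDE.weak_strong_uniqueness` to named sub-facts).
This file **proves** two of those sub-facts:

* `Literature.NS.sobolev_L6_of_weakGradient_R3_holds : sobolev_L6_of_weakGradient_R3` — the Sobolev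
  inequality `‖w‖_{L⁶(ℝ³)} ≤ C‖∇w‖_{L²(ℝ³)}` for `w ∈ L²` with a *weak* gradient
  (Robinson–Rodrigo–Sadowski 2016, Thm. 1.7 (i) with `W₀^{1,2}(ℝ³) = W^{1,2}(ℝ³)`, p. 28), whence
  `Literature.Analysis.FluidPDE.serrin_trilinear_estimate_holds` by the accepted reduction
  `serrin_trilinear_estimate_of_sobolev`;
* `Literature.Fluid.aemeasurable_lintegral_weakGradient_holds : aemeasurable_lintegral_weakGradient` —
  measurability in time of the dissipation `t ↦ ∫ |G t|²` of an a.e.-in-time weak gradient of a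
  jointly measurable field (folklore glue).

## The Sobolev inequality for weak gradients

Let `E` be a real inner product space of dimension `3` with its Lebesgue measure and `F'` a
finite-dimensional real inner product space. For `w ∈ L²(E; F')` with a weak gradient `G`
(accepted `Literature.Fluid.HasWeakGradient w G`, i.e. `HasWeakFDerivOn ⊤ volume w G`) we prove
`‖w‖_{L⁶} ≤ K (∫ |G|²)^{1/2}` with the Frobenius density `|G(x)|² = Fluid.frobeniusNormSq (G x)`
and Mathlib's Gagliardo–Nirenberg–Sobolev constant `K = SNormLESNormFDerivOfEqConst F' volume 2`
(`eLpNorm_six_le_frobenius_of_hasWeakGradient`).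

Proof (Evans, *PDE*, §5.6.1, Thm. 2 via §5.3: approximation by mollification): for the mollifier
sequence `wₙ = φₙ ⋆ w` (`Mollification`), `wₙ` is smooth, lies in `L²` (Young), and
`D wₙ = φₙ ⋆ G` (`HasWeakFDerivOn.fderiv_convolution_apply`), whence
`∫ |Dwₙ|² = Σᵢ ‖φₙ ⋆ (G eᵢ)‖₂² ≤ Σᵢ ‖G eᵢ‖₂² = ∫ |G|²`; the tree's whole-space GNS inequality for `C¹`
functions in `L²` (`Fluid.eLpNorm_six_le_eLpNorm_fderiv_two`, `SobolevWholeSpace`) bounds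
`‖wₙ‖₆ ≤ K ‖Dwₙ‖₂ ≤ K (∫|G|²)^{1/2}` (operator norm `≤` Frobenius norm), and since `wₙ → w` a.e.
(Lebesgue differentiation) Fatou's lemma in `L⁶` (`Lp.eLpNorm_lim_le_liminf_eLpNorm`) concludes.

## The measurability glue

For `u` jointly a.e.-strongly measurable on `(0,T) × E` with `G t` a weak gradient of `u t` for
a.e. `t`: take a jointly measurable version `ũ`; by Fubini `ũ(t,·) = u t` a.e. for a.e. `t`; the
parametric integrals `Aₙⁱ(t,x) = ∫ ∂ᵢφₙ(x - y) ũ(t,y) dy` are jointly measurable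
(`StronglyMeasurable.integral_prod_right'`), equal `φₙ ⋆ ∂ᵢu(t)` for a.e. `t` by the
weak-derivative identity, and converge to `∂ᵢu(t)` a.e. in `x` (Lebesgue differentiation), so
`|G t|² = liminfₙ Σᵢ ‖Aₙⁱ(t,·)‖²` a.e.; the slice integral of the (measurable) right-hand side is
measurable in `t` (`Measurable.lintegral_prod_right'`).

## Mathlib search

Mathlib (this pin) has the GNS inequality only for `C¹` compactly supported functions
(`MeasureTheory.eLpNorm_le_eLpNorm_fderiv_of_eq`); the tree extends it to `C¹ ∩ L^p`
(`SobolevWholeSpace`) and states the `W₀^{1,p}(Ω)` version as the named fact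
`Literature.Analysis.FunctionSpaces.gagliardo_nirenberg_sobolev` and `W = W₀` on `ℝⁿ` via `Literature.Analysis.FunctionSpaces.meyers_serrin` (both unproved).
Neither covers an `L²` function with a weak gradient; this file proves that case for `p = 2`,
`n = 3` directly by mollification.

## References

* L. C. Evans, *Partial Differential Equations*, 2nd ed. (2010), §5.6.1, Thms. 1–2 (GNS and its
  extension to `W^{1,p}` by approximation), §5.3.1, Thm. 1 (mollification of Sobolev functions).
* J. C. Robinson, J. L. Rodrigo, W. Sadowski, *The three-dimensional Navier–Stokes equations*
  (CUP 2016), Thm. 1.7 (i) and the remark `W₀^{1,p}(ℝⁿ) = W^{1,p}(ℝⁿ)`, p. 28; proof of Thm. 8.19.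
* J. Serrin, *The initial value problem for the Navier–Stokes equations*, in: Nonlinear Problems
  (Madison 1962), Univ. Wisconsin Press 1963, §4.
-/

noncomputable section

open MeasureTheory TopologicalSpace Set Function Filter Topology ContinuousLinearMap Module
open scoped ENNReal NNReal Convolution InnerProductSpace RealInnerProductSpace

namespace Literature.Analysis.FluidPDE

variable {E : Type*} [NormedAddCommGroup E] [InnerProductSpace ℝ E] [FiniteDimensional ℝ E]
variable {F' : Type*} [NormedAddCommGroup F'] [InnerProductSpace ℝ F']

/-! ### Frobenius norm: operator-norm bound and the integrated form -/

/-- The operator norm is dominated by the Frobenius norm: `‖L‖ ≤ |L|` with `|L|² = ∑ᵢ ‖L eᵢ‖²`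
(expand `v` in the orthonormal frame and use Cauchy–Schwarz: `‖L v‖ ≤ (∑ᵢ |⟪eᵢ, v⟫|²)^{1/2}
(∑ᵢ ‖L eᵢ‖²)^{1/2} = ‖v‖ |L|`). [folklore] -/
theorem opNorm_le_sqrt_frobeniusNormSq (L : E →L[ℝ] F') :
    ‖L‖ ≤ Real.sqrt (frobeniusNormSq L) := by
  refine ContinuousLinearMap.opNorm_le_bound _ (Real.sqrt_nonneg _) fun v => ?_
  set b := stdOrthonormalBasis ℝ E with hb
  have hv : L v = ∑ i, ⟪b i, v⟫ • L (b i) := by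
    conv_lhs => rw [← b.sum_repr' v]
    simp [map_sum, map_smul]
  have hCS := Finset.sum_mul_sq_le_sq_mul_sq Finset.univ (fun i => |⟪b i, v⟫|) (fun i => ‖L (b i)‖)
  have hpar : ∑ i, |⟪b i, v⟫| ^ 2 = ‖v‖ ^ 2 := by
    rw [← b.sum_sq_norm_inner_right v]
    simp [Real.norm_eq_abs]
  have hfrob : ∑ i, ‖L (b i)‖ ^ 2 = frobeniusNormSq L := rfl
  calc ‖L v‖ = ‖∑ i, ⟪b i, v⟫ • L (b i)‖ := by rw [hv]
    _ ≤ ∑ i, ‖⟪b i, v⟫ • L (b i)‖ := norm_sum_le _ _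
    _ = ∑ i, |⟪b i, v⟫| * ‖L (b i)‖ := by simp [norm_smul]
    _ ≤ Real.sqrt ((∑ i, |⟪b i, v⟫| ^ 2) * ∑ i, ‖L (b i)‖ ^ 2) :=
        (le_abs_self _).trans (Real.abs_le_sqrt hCS)
    _ = Real.sqrt (frobeniusNormSq L) * ‖v‖ := by
        rw [hpar, hfrob, mul_comm, Real.sqrt_mul (frobeniusNormSq_nonneg L),
          Real.sqrt_sq (norm_nonneg _)]

/-- `ℝ≥0∞` form: `‖L‖ₑ² ≤ ofReal |L|²`. [folklore] -/
theorem enorm_sq_le_ofReal_frobeniusNormSq (L : E →L[ℝ] F') :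
    ‖L‖ₑ ^ (2 : ℝ) ≤ ENNReal.ofReal (frobeniusNormSq L) := by
  have h := opNorm_le_sqrt_frobeniusNormSq L
  have h2 : ‖L‖ ^ 2 ≤ frobeniusNormSq L := by
    calc ‖L‖ ^ 2 ≤ Real.sqrt (frobeniusNormSq L) ^ 2 := pow_le_pow_left₀ (norm_nonneg _) h 2
      _ = frobeniusNormSq L := Real.sq_sqrt (frobeniusNormSq_nonneg L)
  calc ‖L‖ₑ ^ (2 : ℝ) = ENNReal.ofReal (‖L‖ ^ 2) := by
        rw [← ofReal_norm, ENNReal.ofReal_rpow_of_nonneg (norm_nonneg _) zero_le_two,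
          Real.rpow_two]
    _ ≤ ENNReal.ofReal (frobeniusNormSq L) := ENNReal.ofReal_le_ofReal h2

variable [MeasurableSpace E]

/-- The `L²` (operator-)norm of a gradient field is bounded by its Frobenius dissipation:
`‖G‖_{L²} ≤ (∫ |G|²)^{1/2}`. [folklore] -/
theorem eLpNorm_two_le_lintegral_frobenius_rpow (μ : Measure E) (G : E → E →L[ℝ] F') :
    eLpNorm G 2 μ ≤ (∫⁻ x, ENNReal.ofReal (frobeniusNormSq (G x)) ∂μ) ^ (1 / 2 : ℝ) := by
  rw [eLpNorm_eq_lintegral_rpow_enorm_toReal two_ne_zero ENNReal.ofNat_ne_top, ENNReal.toReal_ofNat]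
  gcongr with x
  exact enorm_sq_le_ofReal_frobeniusNormSq (G x)

omit [MeasurableSpace E] in
/-- The Frobenius density in `ℝ≥0∞` as a sum over the standard frame:
`ofReal |L|² = ∑ᵢ ‖L eᵢ‖ₑ²`. [folklore] -/
theorem ofReal_frobeniusNormSq_eq_sum (L : E →L[ℝ] F') :
    ENNReal.ofReal (frobeniusNormSq L) = ∑ i, ‖L (stdOrthonormalBasis ℝ E i)‖ₑ ^ (2 : ℝ) := by
  rw [frobeniusNormSq, ENNReal.ofReal_sum_of_nonneg fun i _ => sq_nonneg _]
  refine Finset.sum_congr rfl fun i _ => ?_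
  rw [← ofReal_norm, ENNReal.ofReal_rpow_of_nonneg (norm_nonneg _) zero_le_two, Real.rpow_two]

/-- The Frobenius dissipation is the sum of the `L²` masses of the partial derivatives:
`∫ |G|² = ∑ᵢ ∫ ‖G eᵢ‖²` (standard frame `eᵢ`; a.e.-strongly measurable `G`). [folklore] -/
theorem lintegral_ofReal_frobeniusNormSq_eq_sum {μ : Measure E} {G : E → E →L[ℝ] F'}
    (hG : AEStronglyMeasurable G μ) :
    ∫⁻ x, ENNReal.ofReal (frobeniusNormSq (G x)) ∂μ =
      ∑ i, ∫⁻ x, ‖G x (stdOrthonormalBasis ℝ E i)‖ₑ ^ (2 : ℝ) ∂μ := by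
  simp_rw [ofReal_frobeniusNormSq_eq_sum]
  refine lintegral_finsetSum' _ fun i _ => ?_
  exact ((ContinuousLinearMap.apply ℝ F' (stdOrthonormalBasis ℝ E i)).continuous
    |>.comp_aestronglyMeasurable hG).enorm.pow_const _

/-! ### The Sobolev inequality for weak gradients -/

variable [BorelSpace E] [FiniteDimensional ℝ F']

/-- **Mollification does not increase the dissipation.** For `w` with weak gradient `G` on the
whole space and a normalised bump kernel `φ`, `∫ |D(φ ⋆ w)|² ≤ ∫ |G|²`: componentwise
`D(φ ⋆ w) eᵢ = φ ⋆ (G eᵢ)` (`HasWeakFDerivOn.fderiv_convolution_apply`) and Young's inequality in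
`L²` (`eLpNorm_normed_convolution_le`) (Evans, *PDE*, §5.3.1, Thm. 1 with App. C.4, Thm. 7). [cite: Evans2010, §5.3.1 Thm. 1] -/
theorem lintegral_frobenius_fderiv_normed_convolution_le {w : E → F'} {G : E → E →L[ℝ] F'}
    (hw : HasWeakGradient w G) (φ : ContDiffBump (0 : E)) :
    ∫⁻ x, ENNReal.ofReal
        (frobeniusNormSq (fderiv ℝ (φ.normed volume ⋆[lsmul ℝ ℝ, volume] w) x)) ≤
      ∫⁻ x, ENNReal.ofReal (frobeniusNormSq (G x)) := by
  have hG : AEStronglyMeasurable G volume := (locallyIntegrableOn_univ.1 (by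
    simpa only [Opens.coe_top] using hw.locallyIntegrableOn_deriv)).aestronglyMeasurable
  have hK : FunctionSpaces.IsTestFunctionOn (⊤ : Opens E) (φ.normed volume) := FunctionSpaces.isTestFunctionOn_normed φ
  have hD : ∀ x i, fderiv ℝ (φ.normed volume ⋆[lsmul ℝ ℝ, volume] w) x (stdOrthonormalBasis ℝ E i) =
      (φ.normed volume ⋆[lsmul ℝ ℝ, volume] fun y => G y (stdOrthonormalBasis ℝ E i)) x :=
    fun x i => hw.fderiv_convolution_apply hK x _
  have hC1 : ContDiff ℝ 1 (φ.normed volume ⋆[lsmul ℝ ℝ, volume] w) := hw.contDiff_convolution hK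
  have hmeasD : AEStronglyMeasurable (fderiv ℝ (φ.normed volume ⋆[lsmul ℝ ℝ, volume] w)) volume :=
    (hC1.continuous_fderiv one_ne_zero).aestronglyMeasurable
  rw [lintegral_ofReal_frobeniusNormSq_eq_sum hmeasD, lintegral_ofReal_frobeniusNormSq_eq_sum hG]
  refine Finset.sum_le_sum fun i _ => ?_
  simp_rw [hD]
  have hGi : AEStronglyMeasurable (fun y => G y (stdOrthonormalBasis ℝ E i)) volume :=
    (ContinuousLinearMap.apply ℝ F' _).continuous.comp_aestronglyMeasurable hG
  have hY := FunctionSpaces.eLpNorm_normed_convolution_le φ hGi (p := 2) one_le_two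
  rwa [eLpNorm_eq_lintegral_rpow_enorm_toReal two_ne_zero ENNReal.ofNat_ne_top,
    eLpNorm_eq_lintegral_rpow_enorm_toReal two_ne_zero ENNReal.ofNat_ne_top, ENNReal.toReal_ofNat,
    ENNReal.rpow_le_rpow_iff (by norm_num : (0 : ℝ) < 1 / 2)] at hY

/-- **Sobolev inequality `‖w‖_{L⁶} ≤ K (∫|∇w|²)^{1/2}` for weak gradients in dimension `3`.**
Let `dim E = 3`, `w ∈ L²(E; F')` and let `G` be a weak gradient of `w` on the whole space
(accepted `Fluid.HasWeakGradient`). Then `‖w‖_{L⁶} ≤ K (∫ |G|²)^{1/2}` with the Frobenius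
density `|G|²` and Mathlib's GNS constant `K = SNormLESNormFDerivOfEqConst F' (volume : Measure E) 2` (in
`ℝ≥0∞`; trivial when `∫|G|² = ∞`). This is `W^{1,2}(ℝ³) = W₀^{1,2}(ℝ³) ⊂ L⁶(ℝ³)`
(Robinson–Rodrigo–Sadowski 2016, Thm. 1.7 (i) and p. 28; Evans, *PDE*, §5.6.1, Thm. 2), proved
by mollification: `wₙ = φₙ ⋆ w` is `C¹ ∩ L²`, `‖wₙ‖₆ ≤ K‖Dwₙ‖₂ ≤ K(∫|G|²)^{1/2}` by the tree's
`eLpNorm_six_le_eLpNorm_fderiv_two`, the operator-vs-Frobenius bound and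
`lintegral_frobenius_fderiv_normed_convolution_le`, and `wₙ → w` a.e. with Fatou in `L⁶`. [cite: Evans2010, §5.6.1 Thm. 2] -/
theorem eLpNorm_six_le_frobenius_of_hasWeakGradient (hE : finrank ℝ E = 3) {w : E → F'}
    {G : E → E →L[ℝ] F'} (hw2 : MemLp w 2 volume) (hw : HasWeakGradient w G) :
    eLpNorm w 6 volume ≤ SNormLESNormFDerivOfEqConst F' (volume : Measure E) 2 *
        (∫⁻ x, ENNReal.ofReal (frobeniusNormSq (G x))) ^ (1 / 2 : ℝ) := by
  set D : ℝ≥0∞ := ∫⁻ x, ENNReal.ofReal (frobeniusNormSq (G x)) with hD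
  set Kc : ℝ≥0 := SNormLESNormFDerivOfEqConst F' (volume : Measure E) 2 with hKc
  obtain ⟨φ, hφ, h'φ⟩ := FunctionSpaces.exists_contDiffBump_seq (E := E)
  set wn : ℕ → E → F' := fun n => (φ n).normed volume ⋆[lsmul ℝ ℝ, volume] w with hwn
  have hwloc : LocallyIntegrable w volume := locallyIntegrableOn_univ.1 (by
    simpa only [Opens.coe_top] using hw.locallyIntegrableOn)
  have h1 : ∀ n, ContDiff ℝ 1 (wn n) := fun n =>
    hw.contDiff_convolution (FunctionSpaces.isTestFunctionOn_normed (φ n))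
  have h2 : ∀ n, eLpNorm (wn n) 2 volume < (⊤ : ℝ≥0∞) := fun n =>
    (FunctionSpaces.memLp_normed_convolution (φ n) hw2 one_le_two).eLpNorm_lt_top
  have hGNS : ∀ n, eLpNorm (wn n) 6 volume ≤ Kc * D ^ (1 / 2 : ℝ) := fun n =>
    calc eLpNorm (wn n) 6 volume ≤ Kc * eLpNorm (fderiv ℝ (wn n)) 2 volume :=
          eLpNorm_six_le_eLpNorm_fderiv_two volume hE (h1 n) (h2 n)
      _ ≤ Kc * (∫⁻ x, ENNReal.ofReal (frobeniusNormSq (fderiv ℝ (wn n) x))) ^ (1 / 2 : ℝ) := by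
          gcongr
          exact eLpNorm_two_le_lintegral_frobenius_rpow volume _
      _ ≤ Kc * D ^ (1 / 2 : ℝ) := by
          gcongr
          exact lintegral_frobenius_fderiv_normed_convolution_le hw (φ n)
  have hlim : ∀ᵐ x ∂(volume : Measure E), Tendsto (fun n => wn n x) atTop (𝓝 (w x)) :=
    FunctionSpaces.ae_tendsto_normed_convolution hφ h'φ hwloc
  have hFatou : eLpNorm w 6 volume ≤ atTop.liminf fun n => eLpNorm (wn n) 6 volume :=
    Lp.eLpNorm_lim_le_liminf_eLpNorm (fun n => (h1 n).continuous.aestronglyMeasurable) w hlim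
  calc eLpNorm w 6 volume ≤ atTop.liminf fun n => eLpNorm (wn n) 6 volume := hFatou
    _ ≤ atTop.liminf fun _ : ℕ => (Kc : ℝ≥0∞) * D ^ (1 / 2 : ℝ) :=
        liminf_le_liminf (Eventually.of_forall hGNS)
    _ = Kc * D ^ (1 / 2 : ℝ) := liminf_const _

/-- Packaged form with a universal constant: in dimension `3` there is `C` (Mathlib's GNS
constant) with `‖w‖_{L⁶} ≤ C (∫|G|²)^{1/2}` for every `w ∈ L²` with weak gradient `G`
(Robinson–Rodrigo–Sadowski 2016, Thm. 1.7 (i); Evans, *PDE*, §5.6.1, Thm. 2). [cite: Evans2010, §5.6.1 Thm. 2] -/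
theorem exists_eLpNorm_six_le_of_hasWeakGradient (hE : finrank ℝ E = 3) :
    ∃ C : ℝ≥0, ∀ (w : E → F') (G : E → E →L[ℝ] F'), MemLp w 2 volume → HasWeakGradient w G →
      eLpNorm w 6 volume ≤ C * (∫⁻ x, ENNReal.ofReal (frobeniusNormSq (G x))) ^ (1 / 2 : ℝ) :=
  ⟨SNormLESNormFDerivOfEqConst F' (volume : Measure E) 2, fun _ _ hw2 hw =>
    eLpNorm_six_le_frobenius_of_hasWeakGradient hE hw2 hw⟩

/-- **`H¹(ℝ³) ⊂ L⁶(ℝ³)` for weak gradients on `EuclideanSpace ℝ (Fin 3)`**, in the exact shape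
of the named fact `Literature.Analysis.FluidPDE.sobolev_L6_of_weakGradient_R3` (Robinson–Rodrigo–Sadowski 2016,
Thm. 1.7 (i) and p. 28): there is `C` with `‖w‖₆ ≤ C (∫|G|²)^{1/2}` for all
`w ∈ L²(ℝ³; ℝ³)` with weak gradient `G`. [cite: RobinsonRodrigoSadowski2016, Thm. 1.7 (i)] -/
theorem exists_eLpNorm_six_le_of_hasWeakGradient_euclidean :
    ∃ C : ℝ≥0, ∀ (w : EuclideanSpace ℝ (Fin 3) → EuclideanSpace ℝ (Fin 3))
      (G : EuclideanSpace ℝ (Fin 3) → EuclideanSpace ℝ (Fin 3) →L[ℝ] EuclideanSpace ℝ (Fin 3)),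
      MemLp w 2 volume → HasWeakGradient w G →
        eLpNorm w 6 volume ≤ C * (∫⁻ x, ENNReal.ofReal (frobeniusNormSq (G x))) ^ (1 / 2 : ℝ) :=
  exists_eLpNorm_six_le_of_hasWeakGradient (by simp)

end Literature.Analysis.FluidPDE

/-! ## F0: measurability in time of the dissipation of an a.e.-in-time weak gradient -/

namespace Literature.Analysis.FluidPDE

open MeasureTheory TopologicalSpace Set Function Filter Topology ContinuousLinearMap
open scoped ENNReal NNReal Convolution InnerProductSpace RealInnerProductSpace

variable {E : Type*} [NormedAddCommGroup E] [InnerProductSpace ℝ E] [FiniteDimensional ℝ E]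
  [MeasurableSpace E] [BorelSpace E]

/-- **Discharge** of `Fluid.aemeasurable_lintegral_weakGradient` (folklore measurability glue of
Serrin 1963, §4 / Robinson–Rodrigo–Sadowski 2016, proof of Thm. 8.19). Proof: let `ũ` be a
jointly measurable version of `u` on `(0,T) × E`; by Fubini `ũ(t,·) = u t` a.e. for a.e. `t`. For a
mollifier sequence `φₙ` put `Aₙⁱ(t,x) = ∫ ∂ᵢφₙ(x - y) ũ(t,y) dy`, a parametric integral of a jointly
measurable integrand, hence jointly measurable (`StronglyMeasurable.integral_prod_right'`). For
a.e. `t`, the weak-derivative identity gives `Aₙⁱ(t,·) = φₙ ⋆ ∂ᵢu(t)` and Lebesgue differentiation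
gives `Aₙⁱ(t,x) → ∂ᵢu(t)(x)` for a.e. `x`, so `|G t x|² = liminfₙ Σᵢ ‖Aₙⁱ(t,x)‖²` a.e. in `x`; the
right-hand side is jointly measurable, so its slice integral is measurable in `t`
(`Measurable.lintegral_prod_right'`) and agrees with `t ↦ ∫ |G t|²` for a.e. `t`. [folklore] -/
theorem aemeasurable_lintegral_weakGradient_holds :
    aemeasurable_lintegral_weakGradient (E := E) := by
  intro T u G hu hG
  classical
  obtain ⟨φ, hφ, h'φ⟩ := FunctionSpaces.exists_contDiffBump_seq (E := E)
  set b := stdOrthonormalBasis ℝ E with hb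
  set K : ℕ → E → ℝ := fun n => (φ n).normed volume with hK
  -- a jointly measurable version of `u`
  set ut : ℝ × E → E := hu.mk (uncurry u) with hut
  have hut_meas : StronglyMeasurable ut := hu.stronglyMeasurable_mk
  have hut_ae : uncurry u =ᵐ[volume.restrict (Ioo 0 T ×ˢ univ)] ut := hu.ae_eq_mk
  have hslice : ∀ᵐ t ∂(volume.restrict (Ioo 0 T)), ∀ᵐ x ∂(volume : Measure E),
      u t x = ut (t, x) := by
    have h1 : ((volume : Measure (ℝ × E)).restrict (Ioo 0 T ×ˢ (univ : Set E))) =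
        ((volume : Measure ℝ).restrict (Ioo 0 T)).prod (volume : Measure E) := by
      rw [Measure.volume_eq_prod, ← Measure.prod_restrict, Measure.restrict_univ]
    rw [h1] at hut_ae
    exact Measure.ae_ae_of_ae_prod hut_ae
  -- the approximants `Aₙⁱ(t,x) = ∫ ∂ᵢφₙ(x - y) ũ(t,y) dy`
  set A : ℕ → Fin (Module.finrank ℝ E) → ℝ × E → E := fun n i p =>
    ∫ y, (fderiv ℝ (K n) (p.2 - y) (b i)) • ut (p.1, y) with hA
  have hA_meas : ∀ n i, StronglyMeasurable (A n i) := by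
    intro n i
    have hcont : Continuous fun q : (ℝ × E) × E => fderiv ℝ (K n) (q.1.2 - q.2) (b i) :=
      (((φ n).contDiff_normed (n := 1)).continuous_fderiv one_ne_zero).comp
        ((continuous_snd.comp continuous_fst).sub continuous_snd) |>.clm_apply continuous_const
    have hu' : StronglyMeasurable fun q : (ℝ × E) × E => ut (q.1.1, q.2) :=
      hut_meas.comp_measurable ((measurable_fst.comp measurable_fst).prodMk measurable_snd)
    have hF : StronglyMeasurable fun q : (ℝ × E) × E =>
        (fderiv ℝ (K n) (q.1.2 - q.2) (b i)) • ut (q.1.1, q.2) :=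
      hcont.stronglyMeasurable.smul hu'
    exact hF.integral_prod_right' (ν := (volume : Measure E))
  -- the jointly measurable candidate density
  set Φ : ℝ × E → ℝ≥0∞ := fun p =>
    liminf (fun n => ENNReal.ofReal (∑ i, ‖A n i p‖ ^ 2)) atTop with hΦ
  have hΦ_meas : Measurable Φ := by
    refine Measurable.liminf fun n => ?_
    refine ENNReal.measurable_ofReal.comp ?_
    refine Finset.measurable_sum _ fun i _ => ?_
    exact (hA_meas n i).norm.measurable.pow_const _
  -- identification of the slices for a.e. `t`
  have hkey : ∀ᵐ t ∂(volume.restrict (Ioo 0 T)),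
      (fun x => ENNReal.ofReal (frobeniusNormSq (G t x))) =ᵐ[volume] fun x => Φ (t, x) := by
    filter_upwards [hslice, hG] with t ht hGt
    have hGloc : LocallyIntegrable (G t) volume := locallyIntegrableOn_univ.1 (by
      simpa only [Opens.coe_top] using hGt.locallyIntegrableOn_deriv)
    have hGi : ∀ i, LocallyIntegrable (fun y => G t y (b i)) volume := fun i =>
      locallyIntegrableOn_univ.1
        ((ContinuousLinearMap.apply ℝ E (b i)).locallyIntegrableOn_comp
          (locallyIntegrableOn_univ.2 hGloc))
    -- identification `Aₙⁱ(t, ·) = φₙ ⋆ ∂ᵢu(t)`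
    have hAeq : ∀ n i x, A n i (t, x) = (K n ⋆[lsmul ℝ ℝ, volume] fun y => G t y (b i)) x := by
      intro n i x
      have hKt : FunctionSpaces.IsTestFunctionOn (⊤ : Opens E) (K n) := FunctionSpaces.isTestFunctionOn_normed (φ n)
      calc A n i (t, x) = ∫ y, (fderiv ℝ (K n) (x - y) (b i)) • u t y := by
            simp only [hA]
            refine integral_congr_ae ?_
            filter_upwards [ht] with y hy
            rw [hy]
        _ = ∫ y, K n (x - y) • G t y (b i) := hGt.integral_fderiv_comp_sub_smul hKt x (b i)
        _ = ∫ s, K n s • G t (x - s) (b i) := by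
            rw [← integral_sub_left_eq_self (fun s => K n s • G t (x - s) (b i)) volume x]
            simp only [sub_sub_cancel]
        _ = (K n ⋆[lsmul ℝ ℝ, volume] fun y => G t y (b i)) x := by
            rw [convolution_def]
            simp only [lsmul_apply]
    -- Lebesgue differentiation, componentwise
    have hconv : ∀ᵐ x ∂(volume : Measure E), ∀ i,
        Tendsto (fun n => A n i (t, x)) atTop (𝓝 (G t x (b i))) := by
      refine ae_all_iff.2 fun i => ?_
      filter_upwards [FunctionSpaces.ae_tendsto_normed_convolution hφ h'φ (hGi i)] with x hx
      simpa only [hAeq] using hx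
    filter_upwards [hconv] with x hx
    have hsum : Tendsto (fun n => ∑ i, ‖A n i (t, x)‖ ^ 2) atTop
        (𝓝 (∑ i, ‖G t x (b i)‖ ^ 2)) :=
      tendsto_finsetSum _ fun i _ => ((hx i).norm).pow 2
    have hfrob : frobeniusNormSq (G t x) = ∑ i, ‖G t x (b i)‖ ^ 2 := rfl
    have hlim : Tendsto (fun n => ENNReal.ofReal (∑ i, ‖A n i (t, x)‖ ^ 2)) atTop
        (𝓝 (ENNReal.ofReal (frobeniusNormSq (G t x)))) := by
      rw [hfrob]
      exact (ENNReal.continuous_ofReal.tendsto _).comp hsum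
    simp only [hΦ]
    exact hlim.liminf_eq.symm
  -- conclusion: the slice integral of `Φ` is measurable and agrees with the target a.e.
  have hmeas : Measurable fun t => ∫⁻ x, Φ (t, x) ∂(volume : Measure E) :=
    hΦ_meas.lintegral_prod_right'
  refine hmeas.aemeasurable.congr ?_
  filter_upwards [hkey] with t ht
  exact (lintegral_congr_ae ht).symm

end Literature.Analysis.FluidPDE

/-! ## The discharges in the shape of the named facts of `NSWeakStrongUniqueness` -/

namespace Literature.Analysis.FluidPDE

open MeasureTheory
open scoped ENNReal NNReal

/-- **Discharge** of `NS.sobolev_L6_of_weakGradient_R3` (Robinson–Rodrigo–Sadowski 2016,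
Thm. 1.7 (i) and p. 28): `H¹(ℝ³) ⊂ L⁶(ℝ³)` for weak gradients, by
`Fluid.exists_eLpNorm_six_le_of_hasWeakGradient_euclidean`. [cite: RobinsonRodrigoSadowski2016, Thm. 1.7 (i)] -/
theorem sobolev_L6_of_weakGradient_R3_holds : sobolev_L6_of_weakGradient_R3 :=
  FluidPDE.exists_eLpNorm_six_le_of_hasWeakGradient_euclidean

/-- **Discharge** of `NS.serrin_trilinear_estimate` (Robinson–Rodrigo–Sadowski 2016, proof of
Thm. 8.19; Serrin 1963, Lemma 1): the accepted reduction `serrin_trilinear_estimate_of_sobolev`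
fed with `sobolev_L6_of_weakGradient_R3_holds`. [cite: RobinsonRodrigoSadowski2016, proof of Thm. 8.19] -/
theorem serrin_trilinear_estimate_holds : serrin_trilinear_estimate :=
  serrin_trilinear_estimate_of_sobolev sobolev_L6_of_weakGradient_R3_holds

end Literature.Analysis.FluidPDE
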